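import Summits.HubbardSuperconductivity.HubbardSuperconductivity.Theorems.InfiniteVolumeFirstNoNormalLimitStateReductions
import Summits.HubbardSuperconductivity.HubbardSuperconductivity.Theorems.BalabanIRBirEveryGroundStateThermalChord
import Summits.HubbardSuperconductivity.HubbardSuperconductivity.Theorems.WeakCouplingBCSWcbcsSsbToTorusLROMomentClosure
import HarnessLib

/-!
# Crux `NoNormalLimitState` (stmt-HubbardSuperconductivity-18533, route `InfiniteVolumeFirst`) —
# the THERMAL re-cut of line `window-gap-transfer`

The registered line `window-gap-transfer` (`Cruxes/NoNormalLimitState/Lines/window_gap_transfer.lean`)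
reduces the crux to ONE zero-temperature stub, `stub_windowGapCofinal`: an `ε`-uniform Kac-window gap
`λ a L² ≤ minEnergyOn (H_L + λ W_ε) K_L − minEnergyOn H_L K_L` of the penalised SECTOR ground-state
energy at cofinally weak coupling (`W_ε = Σ_{|q_m| ≤ ε} L⁻² Δ_d(m)ᴴ Δ_d(m)`, `K_L = szSector N_L 0`).
The crux idea `thermal-pressure-window-gap` (`Cruxes/NoNormalLimitState/Ideas/`) proposes to pay that
stub in the currency a functional-integral engine actually delivers — SECTOR PARTITION FUNCTIONS at a
finite inverse temperature — and asked for a "thermal sandwich" first lemma. This module proves the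
whole re-cut, sorry-free, from the tree's one-vector Peierls–Bogoliubov inequality with an entropy
budget (`Theorems.thermalChord_le_re_rayleigh`, module `BalabanIRBirEveryGroundStateThermalChordCore`):

* `windowPenalty_isHermitian`, `windowPenalty_mulVec_mem_szSector` — `W_ε` is Hermitian and leaves
  every joint sector `(2n, S^z = M)`, `n ≥ 1`, invariant;
* `windowFloor_of_thermalWindowChord` — ONE SIDE, ONE `β`: if
  `β λ a L² + L² log 4 ≤ log re tr (P_K e^{-βH_L}) − log re tr (P_K e^{-β(H_L + λ W_ε)})`
  (`P_K` the orthogonal projection onto `K = szSector (2n) 0`), then EVERY normalised ground state of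
  `H_L` in `K` keeps the window floor `a L² ≤ Σ_{|q_m| ≤ ε} S_ψ(m)` — whatever the degeneracy of the
  ground multiplet, with no gap and no `β → ∞`;
* `stub_thermalWindowChordTransfer` — THE EDGE: the thermal window chord at one
  doping, cofinally weak coupling, every window radius and all large even sides implies the crux
  (floors at every scale ⇒ atom of every pointwise limit, landed `stub_windowFloorAtom`);
* `thermalWindowChord_of_strict_windowGap`, `stub_thermalWindowChordOfWindowGapCofinal` — the
  re-cut asks NO MORE than the registered `T = 0` stub: a strict zero-temperature window gap at side `L`
  gives the thermal chord at `β = (2L² log 4 + 1)/margin`, and `stub_windowGapCofinal` (halving `a` to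
  make its margin strict) gives the cofinal thermal hypothesis, hence the crux again.

So the thermal hypothesis is sandwiched: `stub_windowGapCofinal ⇒ ThermalWindowChordCofinal ⇒
NoNormalLimitState`. What it does NOT do: supply the chord. At fixed `β` the thermal window floor is
false in two dimensions (Koma–Tasaki: no pair order at `T > 0`; quasi-long-range order gives a window
weight `O(ε^η L²)`), so any supplier must take `β = β(L) → ∞` (e.g. `β ≍ L`, an effectively
three-dimensional problem) and must resolve the margin `λ a ≍ e^{−2/(αρU²)}` — the barrier
`PerturbativeInvisibilityOfPairing` is moved into the engine, not removed. Pure finite-dimensional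
algebra over landed lemmas; no definition and no named fact is introduced. Sources: B. Simon, *The
Statistical Mechanics of Lattice Gases* I (1993) §II.13; Bratteli–Robinson II §5.3.1; Tasaki (2020)
App. A and §2.1; Koma–Tasaki, PRL 68 (1992) 3248; Scalapino, Phys. Rep. 250 (1995) §2.
-/

noncomputable section

-- the mandated namespace `Summit.<Summit>.<Problem>.Theorems` repeats `HubbardSuperconductivity`
-- (single-problem summit, D-0017), which the `dupNamespace` linter flags on every declaration
set_option linter.dupNamespace false

namespace Summit.HubbardSuperconductivity.HubbardSuperconductivity.Theorems.NoNormalLimitState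

open Literature.MathematicalPhysics.QuantumLattice Literature.Probability.LatticeModels Matrix Finset
  Filter
open Summit.HubbardSuperconductivity.HubbardSuperconductivity.Theses
open scoped ComplexConjugate ComplexOrder Topology

/-! ### The Kac-window penalty `W_ε`: Hermitian, sector-preserving -/

/-- The Kac-window penalty `W_ε = Σ_{|q_m| ≤ ε} L⁻² Δ_d(m)ᴴ Δ_d(m)` is Hermitian. [folklore] -/
theorem windowPenalty_isHermitian (L : ℕ) [NeZero L] (ε : ℝ) :
    (∑ m : TorusSite 2 L, if momentumNormSq L m ≤ ε ^ 2 then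
        ((L : ℂ) ^ 2)⁻¹ • ((pairFieldAt dWaveFormFactor L m)ᴴ * pairFieldAt dWaveFormFactor L m)
        else 0).IsHermitian := by
  unfold Matrix.IsHermitian
  rw [conjTranspose_sum]
  refine Finset.sum_congr rfl fun m _ => ?_
  split_ifs with hm
  · rw [conjTranspose_smul, conjTranspose_mul, conjTranspose_conjTranspose]
    congr 1
    rw [Complex.star_def, map_inv₀, map_pow, Complex.conj_natCast]
  · exact conjTranspose_zero

/-- The Kac-window penalty preserves every joint sector `(2n, S^z = M)` with `n ≥ 1`
(`Δ_d(m)` lowers the particle number by two at fixed `S^z`, `Δ_d(m)ᴴ` raises it back: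
`WcbcsSsbToTorusLRO.pairFieldAt_mulVec_mem_szSector` and its adjoint). Tasaki (2020) §9.3. [folklore] -/
theorem windowPenalty_mulVec_mem_szSector (L : ℕ) [NeZero L] (ε : ℝ) {n : ℕ} (hn : 1 ≤ n) {M : ℝ}
    {v : Fock (Orb (FermionTorus 2 L))} (hv : v ∈ szSector (Λ := FermionTorus 2 L) (2 * n) M) :
    (∑ m : TorusSite 2 L, if momentumNormSq L m ≤ ε ^ 2 then
        ((L : ℂ) ^ 2)⁻¹ • ((pairFieldAt dWaveFormFactor L m)ᴴ * pairFieldAt dWaveFormFactor L m)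
        else 0) *ᵥ v ∈ szSector (Λ := FermionTorus 2 L) (2 * n) M := by
  rw [sum_mulVec]
  refine Submodule.sum_mem _ fun m _ => ?_
  split_ifs with hm
  · rw [smul_mulVec, ← mulVec_mulVec]
    refine Submodule.smul_mem _ _ ?_
    have h2 : 2 ≤ 2 * n := by omega
    have h := WcbcsSsbToTorusLRO.conjTranspose_pairFieldAt_mulVec_mem_szSector dWaveFormFactor m
      (WcbcsSsbToTorusLRO.pairFieldAt_mulVec_mem_szSector dWaveFormFactor m h2 hv)
    rwa [show 2 * n - 2 + 2 = 2 * n by omega] at h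
  · rw [zero_mulVec]
    exact Submodule.zero_mem _

/-! ### One side, one `β`: the thermal window chord bounds the window weight of EVERY ground state -/

/-- **Every sector ground state keeps the window floor, from a thermal window chord.** Side
`L ≥ 1`, coupling `U`, window radius `ε`, strengths `λ, β > 0`, sector `K = szSector (2n) 0` with
orthogonal projection `P_K`, `H = hubbardTorus 2 L 1 U`, `W_ε` the Kac-window penalty. If
`β λ (a L²) + L² log 4 ≤ log re tr (P_K e^{-βH}) − log re tr (P_K e^{-β(H + λ W_ε)})` — the penalty
raises the sector free energy by at least `λ a L² + (L² log 4)/β` — then every normalised ground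
state `ψ` of `H` in `K` has `a L² ≤ Σ_{|q_m| ≤ ε} S_ψ(m)`: the one-vector Peierls–Bogoliubov
inequality `re tr (P_K e^{-β(H+λW)}) ≥ e^{-β(e₀ + λ re⟨ψ,Wψ⟩)}` against the entropy budget
`re tr (P_K e^{-βH}) ≤ dim K · e^{-β e₀} ≤ 4^{L²} e^{-β e₀}` (`Theorems.thermalChord_le_re_rayleigh`,
`Theorems.finrank_szSector_fermionTorus_le`) and `re ⟨ψ, W_ε ψ⟩ = Σ_{|q_m| ≤ ε} S_ψ(m)`
(`re_expect_windowPenalty`). Degeneracy-blind: no gap, no genericity, no `β → ∞`.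
B. Simon, *Statistical Mechanics of Lattice Gases* I §II.13; Tasaki (2020) App. A. [folklore] -/
theorem windowFloor_of_thermalWindowChord (L : ℕ) [NeZero L] (U ε : ℝ) {lam β a : ℝ}
    (hlam : 0 < lam) (hβ : 0 < β) (n : ℕ) {ψ : Fock (Orb (FermionTorus 2 L))}
    (hψ1 : star ψ ⬝ᵥ ψ = 1) (hψ : IsGroundStateInSector (hubbardTorus 2 L 1 U) (2 * n) 0 ψ)
    (hchord : β * lam * (a * (L : ℝ) ^ 2) + (L : ℝ) ^ 2 * Real.log 4 ≤
      Real.log (projMatrix ((szSector (Λ := FermionTorus 2 L) (2 * n) 0).map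
          (Fock.toEuclidean (ι := Orb (FermionTorus 2 L)) :
            Fock (Orb (FermionTorus 2 L)) →ₗ[ℂ] EuclideanSpace ℂ (Finset (Orb (FermionTorus 2 L))))) *
          gibbsWeight β (hubbardTorus 2 L 1 U)).trace.re -
        Real.log (projMatrix ((szSector (Λ := FermionTorus 2 L) (2 * n) 0).map
          (Fock.toEuclidean (ι := Orb (FermionTorus 2 L)) :
            Fock (Orb (FermionTorus 2 L)) →ₗ[ℂ] EuclideanSpace ℂ (Finset (Orb (FermionTorus 2 L))))) *
          gibbsWeight β (hubbardTorus 2 L 1 U + (lam : ℂ) • ∑ m : TorusSite 2 L,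
            if momentumNormSq L m ≤ ε ^ 2 then
              ((L : ℂ) ^ 2)⁻¹ • ((pairFieldAt dWaveFormFactor L m)ᴴ * pairFieldAt dWaveFormFactor L m)
            else 0)).trace.re) :
    a * (L : ℝ) ^ 2 ≤ ∑ m : TorusSite 2 L,
      if momentumNormSq L m ≤ ε ^ 2 then pairStructureFactor dWaveFormFactor L ψ m else 0 := by
  set H := hubbardTorus 2 L 1 U with hHdef
  set S := szSector (Λ := FermionTorus 2 L) (2 * n) 0 with hSdef
  set W : Matrix (Finset (Orb (FermionTorus 2 L))) (Finset (Orb (FermionTorus 2 L))) ℂ :=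
    ∑ m : TorusSite 2 L, if momentumNormSq L m ≤ ε ^ 2 then
      ((L : ℂ) ^ 2)⁻¹ • ((pairFieldAt dWaveFormFactor L m)ᴴ * pairFieldAt dWaveFormFactor L m)
      else 0 with hWdef
  set PS := projMatrix (S.map (Fock.toEuclidean (ι := Orb (FermionTorus 2 L)) :
    Fock (Orb (FermionTorus 2 L)) →ₗ[ℂ] EuclideanSpace ℂ (Finset (Orb (FermionTorus 2 L)))))
    with hPSdef
  have hH : H.IsHermitian := LiebThm1.hamiltonian_isHermitian (fermionTorusGraph 2 L) 1 U
  have hW : W.IsHermitian := windowPenalty_isHermitian L ε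
  have hinv : ∀ v ∈ S, H *ᵥ v ∈ S := fun v hv => szSector_invariant_hubbardTorus 2 L 1 U _ hv
  obtain ⟨hmem, hne, heig⟩ := hψ
  -- the one-vector Peierls–Bogoliubov inequality with the entropy budget `log dim S`
  -- (`Fock.toEuclidean` is definitionally `(WithLp.linearEquiv 2 ℂ _).symm`, so the ascription holds)
  have h : (Real.log (PS * gibbsWeight β H).trace.re -
      Real.log (PS * gibbsWeight β (H + (lam : ℂ) • W)).trace.re -
      Real.log (Module.finrank ℂ S)) / (β * lam) ≤ (star ψ ⬝ᵥ W *ᵥ ψ).re :=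
    Theorems.thermalChord_le_re_rayleigh hH hW S hinv hmem hψ1 heig hlam hβ
  have hWexp : (star ψ ⬝ᵥ W *ᵥ ψ).re = ∑ m : TorusSite 2 L,
      if momentumNormSq L m ≤ ε ^ 2 then pairStructureFactor dWaveFormFactor L ψ m else 0 := by
    rw [hWdef]
    exact re_expect_windowPenalty L ε ψ
  rw [hWexp] at h
  -- `1 ≤ dim S ≤ 4^{L²}`
  have hd1 : (1 : ℝ) ≤ Module.finrank ℂ S := by
    have : 0 < Module.finrank ℂ S := Module.finrank_pos_iff_exists_ne_zero.mpr
      ⟨⟨ψ, hmem⟩, fun h0 => hne (by simpa using congrArg Subtype.val h0)⟩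
    exact_mod_cast this
  have hbudget : Real.log (Module.finrank ℂ S) ≤ (L : ℝ) ^ 2 * Real.log 4 := by
    have h4 : (Module.finrank ℂ S : ℝ) ≤ (4 : ℝ) ^ (L ^ 2) := by
      exact_mod_cast Theorems.finrank_szSector_fermionTorus_le L (2 * n) 0
    calc Real.log (Module.finrank ℂ S) ≤ Real.log ((4 : ℝ) ^ (L ^ 2)) :=
          Real.log_le_log (by linarith) h4
      _ = (L : ℝ) ^ 2 * Real.log 4 := by rw [Real.log_pow]; push_cast; ring
  rw [div_le_iff₀ (by positivity)] at h
  -- assemble: `β λ (a L²) ≤ (log Z₀ − log Z₁ − L² log 4) ≤ (log Z₀ − log Z₁ − log dim S) ≤ β λ Σ`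
  have hβlam : 0 < β * lam := mul_pos hβ hlam
  have key : β * lam * (a * (L : ℝ) ^ 2) ≤ β * lam * ∑ m : TorusSite 2 L,
      if momentumNormSq L m ≤ ε ^ 2 then pairStructureFactor dWaveFormFactor L ψ m else 0 := by
    nlinarith [h, hbudget, hchord]
  exact le_of_mul_le_mul_left key hβlam

/-! ### The edge: a cofinal thermal window chord implies the crux -/

/-- **The thermal re-cut of line `window-gap-transfer`: a cofinal thermal window chord implies
`NoNormalLimitState`.** If at some doping `δ ∈ (0,1/2)`, for every `U₀ > 0`, some `U ∈ (0,U₀)` and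
some `a > 0` have, for every window radius `ε > 0`, a penalty strength `λ > 0` and a threshold beyond
which, at every even side `L`, SOME inverse temperature `β > 0` carries the sector free-energy
increment `β λ a L² + L² log 4 ≤ log re tr (P_{K_L} e^{-βH_L}) − log re tr (P_{K_L} e^{-β(H_L + λ W_ε)})`
(`H_L = hubbardTorus 2 L 1 U`, `K_L = szSector N_L 0`, `N_L = 2⌊(1−δ)L²/2⌋`,
`W_ε = Σ_{|q_m| ≤ ε} L⁻² Δ_d(m)ᴴ Δ_d(m)`), then `NoNormalLimitState`: by
`windowFloor_of_thermalWindowChord` every admissible ground state keeps the window floor `a L²` at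
every scale, and the landed `stub_windowFloorAtom` (lower Fejér bound) turns floors at every scale
into the atom `≥ a > 0` of every pointwise limit. The hypothesis is a statement about two sector
partition functions at finite `β` (the output type of finite-temperature functional-integral
constructions); it must nevertheless be read at `β = β(L) → ∞` (Koma–Tasaki) and resolve the
Kohn–Luttinger margin. (Sub-goal `stub_thermalWindowChordTransfer` registered on the item; the
hypothesis is kept on one line, verbatim the registered text.) B. Simon (1993) §II.13; Koma–Tasaki,
PRL 68 (1992) 3248; Kennedy–Lieb–Shastry, PRL 61 (1988) 2582. [folklore] -/
theorem stub_thermalWindowChordTransfer :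
    (∃ δ ∈ Set.Ioo (0:ℝ) (1 / 2), ∀ U₀ : ℝ, 0 < U₀ → ∃ U ∈ Set.Ioo (0:ℝ) U₀, ∃ a : ℝ, 0 < a ∧ ∀ ε : ℝ, 0 < ε → ∃ lam : ℝ, 0 < lam ∧ ∃ L₀ : ℕ, ∀ (L : ℕ) [NeZero L], Even L → L₀ ≤ L → ∃ β : ℝ, 0 < β ∧ β * lam * (a * (L : ℝ) ^ 2) + (L : ℝ) ^ 2 * Real.log 4 ≤ Real.log (Literature.MathematicalPhysics.QuantumLattice.projMatrix ((Literature.MathematicalPhysics.QuantumLattice.szSector (Λ := Literature.MathematicalPhysics.QuantumLattice.FermionTorus 2 L) (2 * ⌊(1 - δ) * (L : ℝ) ^ 2 / 2⌋₊) 0).map (Literature.MathematicalPhysics.QuantumLattice.Fock.toEuclidean (ι := Literature.MathematicalPhysics.QuantumLattice.Orb (Literature.MathematicalPhysics.QuantumLattice.FermionTorus 2 L)) : Literature.MathematicalPhysics.QuantumLattice.Fock (Literature.MathematicalPhysics.QuantumLattice.Orb (Literature.MathematicalPhysics.QuantumLattice.FermionTorus 2 L)) →ₗ[ℂ] EuclideanSpace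 ℂ (Finset (Literature.MathematicalPhysics.QuantumLattice.Orb (Literature.MathematicalPhysics.QuantumLattice.FermionTorus 2 L))))) * Matrix.gibbsWeight β (Literature.MathematicalPhysics.QuantumLattice.hubbardTorus 2 L 1 U)).trace.re - Real.log (Literature.MathematicalPhysics.QuantumLattice.projMatrix ((Literature.MathematicalPhysics.QuantumLattice.szSector (Λ := Literature.MathematicalPhysics.QuantumLattice.FermionTorus 2 L) (2 * ⌊(1 - δ) * (L : ℝ) ^ 2 / 2⌋₊) 0).map (Literature.MathematicalPhysics.QuantumLattice.Fock.toEuclidean (ι := Literature.MathematicalPhysics.QuantumLattice.Orb (Literature.MathematicalPhysics.QuantumLattice.FermionTorus 2 L)) : Literature.MathematicalPhysics.QuantumLattice.Fock (Literature.MathematicalPhysics.QuantumLattice.Orb (Literature.MathematicalPhysics.QuantumLattice.FermionTorus 2 L)) →ₗ[ℂ] EuclideanSpace ℂ (Finset (Literature.MathematicalPhysics.QuantumLattice.Orb (Literature.MathematicalPhysics.QuantumLattice.FermionTorus 2 L))))) * Matrix.gibbsWeight β (Literature.MathematicalPhysics.QuantumLattice.hubbardTorus 2 L 1 U + (lam :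 ℂ) • ∑ m : Literature.Probability.LatticeModels.TorusSite 2 L, if Literature.MathematicalPhysics.QuantumLattice.momentumNormSq L m ≤ ε ^ 2 then ((L : ℂ) ^ 2)⁻¹ • (Matrix.conjTranspose (Literature.MathematicalPhysics.QuantumLattice.pairFieldAt Literature.MathematicalPhysics.QuantumLattice.dWaveFormFactor L m) * Literature.MathematicalPhysics.QuantumLattice.pairFieldAt Literature.MathematicalPhysics.QuantumLattice.dWaveFormFactor L m) else 0)).trace.re) → Summit.HubbardSuperconductivity.HubbardSuperconductivity.Theses.InfiniteVolumeFirst.NoNormalLimitState := by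
  intro h
  obtain ⟨δ, hδ, hU⟩ := h
  refine ⟨δ, hδ, fun U₀ hU₀ => ?_⟩
  obtain ⟨U, hUmem, a, ha, hth⟩ := hU U₀ hU₀
  refine ⟨U, hUmem, fun N ψ hadm Ls C hLs hev hconv => ?_⟩
  have hnorm : ∀ L, Even L → star (ψ L) ⬝ᵥ ψ L = 1 := fun L hL => (hadm L hL).2.1
  have hfloor : ∀ ε : ℝ, 0 < ε → ∃ L₀ : ℕ, ∀ (L : ℕ) [NeZero L], Even L → L₀ ≤ L →
      a * (L : ℝ) ^ 2 ≤ ∑ m : TorusSite 2 L, if momentumNormSq L m ≤ ε ^ 2 then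
        pairStructureFactor dWaveFormFactor L (ψ L) m else 0 := by
    intro ε hε
    obtain ⟨lam, hlam, L₀, hL₀⟩ := hth ε hε
    refine ⟨L₀, fun L _ hLe hLge => ?_⟩
    obtain ⟨hN, hψ1, hgs⟩ := hadm L hLe
    rw [hN] at hgs
    obtain ⟨β, hβ, hchord⟩ := hL₀ L hLe hLge
    exact windowFloor_of_thermalWindowChord L U ε hlam hβ _ hψ1 hgs hchord
  exact lt_of_lt_of_le ha (stub_windowFloorAtom ψ a ha hnorm hfloor Ls C hLs hev hconv)

/-! ### The converse at zero temperature: the re-cut asks no more than the registered stub -/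

/-- **A strict zero-temperature window gap gives the thermal window chord.** Side `L ≥ 1`, sector
`K = szSector (2n) 0` with `1 ≤ n ≤ L²` (non-empty, and preserved by `W_ε`), any real `λ`, `a`: if
`λ (a L²) < minEnergyOn (H + λ W_ε) K − minEnergyOn H K`, then some `β > 0` has
`β λ (a L²) + L² log 4 ≤ log re tr (P_K e^{-βH}) − log re tr (P_K e^{-β(H + λ W_ε)})`
(`log re tr (P_K e^{-βH}) ≥ −β e₀(H)` by one ground state; `log re tr (P_K e^{-β(H+λW_ε)}) ≤
L² log 4 − β e₀(H + λ W_ε)` by the entropy budget; `β = (2 L² log 4 + 1)/margin`). The pattern of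
`Theorems.thermalChord_of_strict_kappaChord` with `W_ε` in place of `L⁻⁴ Δ_dᴴ Δ_d`.
B. Simon (1993) §II.13; Tasaki (2020) App. A. [folklore] -/
theorem thermalWindowChord_of_strict_windowGap (L : ℕ) [NeZero L] (U ε : ℝ) {n : ℕ} (hn : 1 ≤ n)
    (hnL : n ≤ L ^ 2) (lam a : ℝ)
    (hgap : lam * (a * (L : ℝ) ^ 2) <
      (hubbardTorus 2 L 1 U + (lam : ℂ) • ∑ m : TorusSite 2 L,
          if momentumNormSq L m ≤ ε ^ 2 then
            ((L : ℂ) ^ 2)⁻¹ • ((pairFieldAt dWaveFormFactor L m)ᴴ * pairFieldAt dWaveFormFactor L m)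
          else 0).minEnergyOn (szSector (Λ := FermionTorus 2 L) (2 * n) 0) -
        (hubbardTorus 2 L 1 U).minEnergyOn (szSector (Λ := FermionTorus 2 L) (2 * n) 0)) :
    ∃ β : ℝ, 0 < β ∧
      β * lam * (a * (L : ℝ) ^ 2) + (L : ℝ) ^ 2 * Real.log 4 ≤
        Real.log (projMatrix ((szSector (Λ := FermionTorus 2 L) (2 * n) 0).map
            (Fock.toEuclidean (ι := Orb (FermionTorus 2 L)) :
              Fock (Orb (FermionTorus 2 L)) →ₗ[ℂ] EuclideanSpace ℂ (Finset (Orb (FermionTorus 2 L))))) *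
            gibbsWeight β (hubbardTorus 2 L 1 U)).trace.re -
          Real.log (projMatrix ((szSector (Λ := FermionTorus 2 L) (2 * n) 0).map
            (Fock.toEuclidean (ι := Orb (FermionTorus 2 L)) :
              Fock (Orb (FermionTorus 2 L)) →ₗ[ℂ] EuclideanSpace ℂ (Finset (Orb (FermionTorus 2 L))))) *
            gibbsWeight β (hubbardTorus 2 L 1 U + (lam : ℂ) • ∑ m : TorusSite 2 L,
              if momentumNormSq L m ≤ ε ^ 2 then
                ((L : ℂ) ^ 2)⁻¹ • ((pairFieldAt dWaveFormFactor L m)ᴴ * pairFieldAt dWaveFormFactor L m)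
              else 0)).trace.re := by
  set H := hubbardTorus 2 L 1 U with hHdef
  set S := szSector (Λ := FermionTorus 2 L) (2 * n) 0 with hSdef
  set W : Matrix (Finset (Orb (FermionTorus 2 L))) (Finset (Orb (FermionTorus 2 L))) ℂ :=
    ∑ m : TorusSite 2 L, if momentumNormSq L m ≤ ε ^ 2 then
      ((L : ℂ) ^ 2)⁻¹ • ((pairFieldAt dWaveFormFactor L m)ᴴ * pairFieldAt dWaveFormFactor L m)
      else 0 with hWdef
  set PS := projMatrix (S.map (Fock.toEuclidean (ι := Orb (FermionTorus 2 L)) :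
    Fock (Orb (FermionTorus 2 L)) →ₗ[ℂ] EuclideanSpace ℂ (Finset (Orb (FermionTorus 2 L)))))
    with hPSdef
  set e₀ : ℝ := H.minEnergyOn S with he₀
  set e₁ : ℝ := (H + (lam : ℂ) • W).minEnergyOn S with he₁
  set B : ℝ := (L : ℝ) ^ 2 * Real.log 4 with hB
  have hB0 : 0 ≤ B := by positivity
  set mg : ℝ := e₁ - e₀ - lam * (a * (L : ℝ) ^ 2) with hmg
  have hmg0 : 0 < mg := by rw [hmg]; linarith
  -- the objects
  have hH : H.IsHermitian := LiebThm1.hamiltonian_isHermitian (fermionTorusGraph 2 L) 1 U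
  have hW : W.IsHermitian := windowPenalty_isHermitian L ε
  have hX : (H + (lam : ℂ) • W).IsHermitian :=
    hH.add (hW.smul (by rw [isSelfAdjoint_iff, Complex.star_def, Complex.conj_ofReal]))
  have hinvH : ∀ v ∈ S, H *ᵥ v ∈ S := fun v hv => szSector_invariant_hubbardTorus 2 L 1 U _ hv
  have hinvX : ∀ v ∈ S, (H + (lam : ℂ) • W) *ᵥ v ∈ S := by
    intro v hv
    rw [add_mulVec, smul_mulVec]
    exact S.add_mem (hinvH v hv) (S.smul_mem _ (windowPenalty_mulVec_mem_szSector L ε hn hv))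
  -- a normalised sector ground state of `H`
  obtain ⟨ψ, hψ, hgs⟩ :=
    Literature.Barriers.HubbardSuperconductivity.exists_unit_isGroundStateInSector_hubbardTorus U L n hnL
  have hRH : (star ψ ⬝ᵥ H *ᵥ ψ).re = e₀ := by
    rw [hgs.2.2, dotProduct_smul, hψ, smul_eq_mul, mul_one, Complex.ofReal_re]
  -- choose `β`
  refine ⟨(2 * B + 1) / mg, by positivity, ?_⟩
  set β : ℝ := (2 * B + 1) / mg with hβdef
  have hβ : 0 < β := by positivity
  have hβm : β * mg = 2 * B + 1 := by rw [hβdef, div_mul_cancel₀ _ hmg0.ne']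
  -- lower bound on `Z_S(β, H)`
  have hZ0 : Real.exp (-(β * e₀)) ≤ (PS * gibbsWeight β H).trace.re := by
    rw [← hRH]
    exact (Theorems.exp_neg_mul_rayleigh_le_re_gibbsWeight hH β hψ).trans
      (Theorems.re_rayleigh_le_re_trace_projMatrix_mul (posDef_gibbsWeight β hH).posSemidef S hgs.1 hψ)
  -- upper bound on `Z_S(β, H + λW)` by the entropy budget, and positivity
  have hZ1 : (PS * gibbsWeight β (H + (lam : ℂ) • W)).trace.re ≤
      (Module.finrank ℂ S : ℝ) * Real.exp (-(β * e₁)) :=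
    Theorems.re_trace_sectorProj_mul_gibbsWeight_le hX S hinvX hβ.le
  have hZ1pos : 0 < (PS * gibbsWeight β (H + (lam : ℂ) • W)).trace.re :=
    (Real.exp_pos _).trans_le ((Theorems.exp_neg_mul_rayleigh_le_re_gibbsWeight hX β hψ).trans
      (Theorems.re_rayleigh_le_re_trace_projMatrix_mul (posDef_gibbsWeight β hX).posSemidef S hgs.1 hψ))
  have hd1 : (1 : ℝ) ≤ Module.finrank ℂ S := by
    have : 0 < Module.finrank ℂ S := Module.finrank_pos_iff_exists_ne_zero.mpr
      ⟨⟨ψ, hgs.1⟩, fun h0 => hgs.2.1 (by simpa using congrArg Subtype.val h0)⟩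
    exact_mod_cast this
  have hbudget : Real.log (Module.finrank ℂ S) ≤ B := by
    have h4 : (Module.finrank ℂ S : ℝ) ≤ (4 : ℝ) ^ (L ^ 2) := by
      exact_mod_cast Theorems.finrank_szSector_fermionTorus_le L (2 * n) 0
    calc Real.log (Module.finrank ℂ S) ≤ Real.log ((4 : ℝ) ^ (L ^ 2)) :=
          Real.log_le_log (by linarith) h4
      _ = B := by rw [hB, Real.log_pow]; push_cast; ring
  -- logarithms
  have hl0 : -(β * e₀) ≤ Real.log (PS * gibbsWeight β H).trace.re := by
    rw [← Real.log_exp (-(β * e₀))]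
    exact Real.log_le_log (Real.exp_pos _) hZ0
  have hl1 : Real.log (PS * gibbsWeight β (H + (lam : ℂ) • W)).trace.re ≤
      Real.log (Module.finrank ℂ S) + -(β * e₁) := by
    rw [← Real.log_exp (-(β * e₁)), ← Real.log_mul (by positivity) (Real.exp_pos _).ne']
    exact Real.log_le_log hZ1pos hZ1
  have hme : β * e₁ - β * e₀ = β * mg + β * (lam * (a * (L : ℝ) ^ 2)) := by rw [hmg]; ring
  nlinarith [hl0, hl1, hbudget, hβm, hme, hB0]

/-- **The registered stub `stub_windowGapCofinal` implies the cofinal thermal window chord** (the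
hypothesis of `stub_thermalWindowChordTransfer`, with the constant `a` halved). The `T = 0` stub gives
`λ a L² ≤ gap_L` with `λ, a, L > 0`, so the gap is positive and `λ (a/2) L² < gap_L` strictly;
`thermalWindowChord_of_strict_windowGap` (with `N_L = 2⌊(1−δ)L²/2⌋`, `1 ≤ ⌊(1−δ)L²/2⌋ ≤ L²` once
`L ≥ 2`) produces the thermal chord. So, as implications, the thermal line is sandwiched between the
registered line and the crux: `stub_windowGapCofinal ⇒ (cofinal thermal window chord) ⇒
NoNormalLimitState` (this theorem — sub-goal `stub_thermalWindowChordOfWindowGapCofinal` registered on the item, statement on one line verbatim — then `stub_thermalWindowChordTransfer`; compare the direct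
`noNormalLimitState_of_windowGapCofinal`). B. Simon (1993) §II.13; Tasaki (2020) §2.1. [folklore] -/
theorem stub_thermalWindowChordOfWindowGapCofinal :
    (∃ δ ∈ Set.Ioo (0:ℝ) (1 / 2), ∀ U₀ : ℝ, 0 < U₀ → ∃ U ∈ Set.Ioo (0:ℝ) U₀, ∃ a : ℝ, 0 < a ∧ ∀ ε : ℝ, 0 < ε → ∃ lam : ℝ, 0 < lam ∧ ∃ L₀ : ℕ, ∀ (L : ℕ) [NeZero L], Even L → L₀ ≤ L → lam * a * (L : ℝ) ^ 2 ≤ (hubbardTorus 2 L 1 U + (lam : ℂ) • ∑ m : TorusSite 2 L, if momentumNormSq L m ≤ ε ^ 2 then ((L : ℂ) ^ 2)⁻¹ • ((pairFieldAt dWaveFormFactor L m)ᴴ * pairFieldAt dWaveFormFactor L m) else 0).minEnergyOn (szSector (2 * ⌊(1 - δ) * (L : ℝ) ^ 2 / 2⌋₊) 0) - (hubbardTorus 2 L 1 U).minEnergyOn (szSector (2 * ⌊(1 - δ) * (L : ℝ) ^ 2 / 2⌋₊) 0)) → ∃ δ ∈ Set.Ioo (0:ℝ) (1 / 2), ∀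 U₀ : ℝ, 0 < U₀ → ∃ U ∈ Set.Ioo (0:ℝ) U₀, ∃ a : ℝ, 0 < a ∧ ∀ ε : ℝ, 0 < ε → ∃ lam : ℝ, 0 < lam ∧ ∃ L₀ : ℕ, ∀ (L : ℕ) [NeZero L], Even L → L₀ ≤ L → ∃ β : ℝ, 0 < β ∧ β * lam * (a * (L : ℝ) ^ 2) + (L : ℝ) ^ 2 * Real.log 4 ≤ Real.log (projMatrix ((szSector (Λ := FermionTorus 2 L) (2 * ⌊(1 - δ) * (L : ℝ) ^ 2 / 2⌋₊) 0).map (Fock.toEuclidean (ι := Orb (FermionTorus 2 L)) : Fock (Orb (FermionTorus 2 L)) →ₗ[ℂ] EuclideanSpace ℂ (Finset (Orb (FermionTorus 2 L))))) * gibbsWeight β (hubbardTorus 2 L 1 U)).trace.re - Real.log (projMatrix ((szSector (Λ := FermionTorus 2 L) (2 * ⌊(1 - δ) * (L : ℝ) ^ 2 / 2⌋₊) 0).map (Fock.toEuclidean (ι := Orb (FermionTorus 2 L)) : Fock (Orb (FermionTorus 2 L)) →ₗ[ℂ] EuclideanSpace ℂ (Finset (Orb (FermionTorus 2 L))))) *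 gibbsWeight β (hubbardTorus 2 L 1 U + (lam : ℂ) • ∑ m : TorusSite 2 L, if momentumNormSq L m ≤ ε ^ 2 then ((L : ℂ) ^ 2)⁻¹ • ((pairFieldAt dWaveFormFactor L m)ᴴ * pairFieldAt dWaveFormFactor L m) else 0)).trace.re := by
  intro h
  obtain ⟨δ, hδ, hU⟩ := h
  refine ⟨δ, hδ, fun U₀ hU₀ => ?_⟩
  obtain ⟨U, hUmem, a, ha, hgap⟩ := hU U₀ hU₀
  refine ⟨U, hUmem, a / 2, half_pos ha, fun ε hε => ?_⟩
  obtain ⟨lam, hlam, L₀, hL₀⟩ := hgap ε hε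
  refine ⟨lam, hlam, max L₀ 2, fun L _ hLe hLge => ?_⟩
  have hL0 : L₀ ≤ L := le_trans (le_max_left _ _) hLge
  have hL2 : 2 ≤ L := le_trans (le_max_right _ _) hLge
  have hg := hL₀ L hLe hL0
  -- the sector is non-empty and carries at least one pair: `1 ≤ ⌊(1-δ)L²/2⌋ ≤ L²`
  have hn1 : 1 ≤ ⌊(1 - δ) * (L : ℝ) ^ 2 / 2⌋₊ := by
    refine Nat.le_floor ?_
    have hL2' : (2 : ℝ) ≤ (L : ℝ) := by exact_mod_cast hL2
    have hδ2 : (1 : ℝ) / 2 ≤ 1 - δ := by linarith [hδ.2]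
    have hLsq : (4 : ℝ) ≤ (L : ℝ) ^ 2 := by nlinarith
    rw [Nat.cast_one, le_div_iff₀ (by norm_num : (0 : ℝ) < 2)]
    nlinarith
  have hnL : ⌊(1 - δ) * (L : ℝ) ^ 2 / 2⌋₊ ≤ L ^ 2 := by
    refine Nat.floor_le_of_le ?_
    have hL : (0 : ℝ) ≤ (L : ℝ) ^ 2 := by positivity
    push_cast
    nlinarith [hδ.1]
  -- strictness: the gap is positive (it dominates `λ a L² > 0`), so halving `a` gives a strict margin
  have hLpos : (0 : ℝ) < (L : ℝ) ^ 2 := by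
    have : (0 : ℝ) < (L : ℝ) := by exact_mod_cast lt_of_lt_of_le (by norm_num : 0 < 2) hL2
    positivity
  have hpos : 0 < lam * a * (L : ℝ) ^ 2 := by positivity
  have hstrict : lam * (a / 2 * (L : ℝ) ^ 2) <
      (hubbardTorus 2 L 1 U + (lam : ℂ) • ∑ m : TorusSite 2 L,
          if momentumNormSq L m ≤ ε ^ 2 then
            ((L : ℂ) ^ 2)⁻¹ • ((pairFieldAt dWaveFormFactor L m)ᴴ * pairFieldAt dWaveFormFactor L m)
          else 0).minEnergyOn (szSector (Λ := FermionTorus 2 L) (2 * ⌊(1 - δ) * (L : ℝ) ^ 2 / 2⌋₊) 0) -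
        (hubbardTorus 2 L 1 U).minEnergyOn
          (szSector (Λ := FermionTorus 2 L) (2 * ⌊(1 - δ) * (L : ℝ) ^ 2 / 2⌋₊) 0) := by
    have hhalf : lam * (a / 2 * (L : ℝ) ^ 2) = lam * a * (L : ℝ) ^ 2 / 2 := by ring
    rw [hhalf]
    linarith
  exact thermalWindowChord_of_strict_windowGap L U ε hn1 hnL lam (a / 2) hstrict

end Summit.HubbardSuperconductivity.HubbardSuperconductivity.Theorems.NoNormalLimitState

end
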